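import Literature.NumberTheory.GaloisCohomology.RestrictedRamificationFiniteCoefficients
import Literature.NumberTheory.IwasawaTheory.Greenberg2016.SelmerGroupStructure
import Literature.NumberTheory.GaloisRepresentations.DiscreteCochains
import HarnessLib

/-!
# The `G_S` / `Γ_K` bridge for Greenberg's arena: `Hⁿ(G_S, A^{N_S}) ≃+ Hⁿ(K_Σ/K, A)` and
# `Hⁿ(Γ_{K_v}, A) ≃+ Hⁿ(K_v, A)`, COMPATIBLY WITH LOCALISATION and with the coefficient maps

Topic `NumberTheory/IwasawaTheory/Greenberg2016`; namespace
`Literature.NumberTheory.IwasawaTheory.Greenberg2016`.  Definitions with bodies (explicit comparison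
isomorphisms) and theorems; no named fact, no `sorry`, no instance, no notation.

Greenberg (*On the structure of Selmer groups*, 2016, §1 p. 3; *Surjectivity of the global-to-local
map defining a Selmer group*, Kyoto J. Math. 50 (2010), §1) works with a discrete `Λ`-module `A`
carrying a continuous `Λ`-linear action `τ` of `Gal(K_Σ/K) = G_{K,S}` (the tree's dictionary
`SelmerGroupStructure.lean`: `τ : ContinuousRep (GaloisGroupUnramifiedOutside K S) Λ A`, global
cohomology `τ.H n = Hⁿ(K_Σ/K, A)`, local representation `localRep S τ v = τ|_{Γ_{K_v}}` along
`Γ_{K_v} → Γ_K ↠ G_{K,S}`, localisation `loc S τ v n`, coefficient maps `Hmap`).  The tree's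
Poitou–Tate theorems for FINITE modules (Milne ADT I Thm. 4.10, Harari Thm. 17.13; files
`GaloisCohomology/PoitouTate*.lean`, the X3 chain's `…_canonical_holds`) live instead on DISCRETE
`Γ_K`-MODULES (`DiscreteGaloisModule K A`, `ℤ`-linear): `galoisCohomology`, `localization`,
`restrictedCohomology σ S n = Hⁿ(G_S, A^{N_S})`, `restrictedInf`, `restrictedLocalization`
(`PoitouTateRestrictedRamification.lean` §1).  Passing from one currency to the other is "view the
`G_S`-module `A` as a `Γ_K`-module through `Γ_K ↠ G_S` and forget the `Λ`-structure" — in print a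
tautology (Harari §17.2 p. 290: "We have restriction maps `Hⁱ(G_S, M) → Hⁱ(G_v, M)` (defined for any
place `v` of `k` …)"; Milne I §4 p. 55), in the kernel two comparison isomorphisms of Mathlib's
continuous cochain cohomology whose COMPATIBILITY WITH THE LOCALISATION MAPS has to be proved.
`RestrictedRamificationFiniteCoefficients.lean` (§2 there) has the global isomorphism as a bare
`Nonempty` (enough to transfer finiteness); this file names it and proves the compatibilities:

* §1 `toGaloisModule S τ` — the inflated discrete `Γ_K`-module `(τ|_ℤ) ∘ (Γ_K ↠ G_{K,S})` (an
  `abbrev` for the term used verbatim in `RestrictedRamificationFiniteCoefficients.lean`); it is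
  unramified outside `S` (`isUnramifiedOutside_toGaloisModule`), and ITS LOCAL MODULE AT `v` IS
  GREENBERG'S `localRep S τ v` WITH SCALARS RESTRICTED TO `ℤ`, definitionally (`toGaloisModule_toLocal`).
* §2 `restrictedHAddEquiv S τ n : Hⁿ(G_S, A^{N_S}) ≃+ τ.H n` — the global comparison (`A^{N_S} = A`
  by `invariantsRamificationEquiv`, continuous cohomology does not see the scalars:
  `ContinuousRep.HAddEquivOfContinuousAddEquiv` of `ContinuousCohomologyAdditiveTransport.lean`).
* §3 `localHAddEquiv S τ v n : Hⁿ(Γ_{K_v}, A) (the `galoisCohomology` of the local module of §1)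
  ≃+ (localRep S τ v).H n` — the local comparison (`ContinuousRep.restrictScalarsH ℤ`).
* §4 **`loc_restrictedHAddEquiv`** — THE SQUARE: `loc_v ∘ restrictedHAddEquiv =
  localHAddEquiv ∘ restrictedLocalization_v` (both composites are `Hⁿ` of the same pair
  (`Γ_{K_v} → G_{K,S}`, `A^{N_S} ⊆ A`); naturality `continuousCohomologyAddEquiv_map` and Mathlib's
  `ContinuousCohomology.map_comp`); `Hpullback_restrictedHAddEquiv` — the same for the inflation
  `Hⁿ(G_S, A^{N_S}) → Hⁿ(Γ_K, A)` (`restrictedInf`) against Greenberg's pull-back along `Γ_K ↠ G_{K,S}`.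
* §5 naturality in the coefficients: for a `G_{K,S}`-equivariant continuous `Λ`-linear `u : A → B`,
  `Hmap ∘ restrictedHAddEquiv = restrictedHAddEquiv ∘ Hⁿ(G_S, u^{N_S})` (`Hmap_restrictedHAddEquiv`,
  with `ContinuousRep.invariantsHom`) and `Hmap ∘ localHAddEquiv = localHAddEquiv ∘ Hⁿ(Γ_{K_v}, u)`
  (`Hmap_localHAddEquiv`, with `galoisCohomology.map`).

## Why (where this is used)

Road «SUR-Λ» of cell `bsd-eis` (kernel discharge of Greenberg 2016 Prop. 2.6.3 = Greenberg 2010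
Prop. 3.2.1, `Greenberg2016.prop263_sur_of_crk`, in case (c)): the finite levels `A = 𝐃[𝔪ᵏ]` of a
`Λ`-adic `𝐃` are moved to `Γ_K`, where Poitou–Tate duality is available, and the classes produced
there are moved back to `Hⁿ(K_Σ/K, 𝐃)` and compared with LOCAL data through `loc S ρ v` — which is
exactly the square of §4.  Nothing is asserted about any arithmetic object; no case of Poitou–Tate
duality and no case of BSD is proved here.

## References
* D. Harari, *Galois Cohomology and Class Field Theory*, Universitext (2020), Def. 15.36, §17.2
  (p. 290), Remark 17.7 (b). [Harari2020]
* J. S. Milne, *Arithmetic Duality Theorems*, 2nd ed. (2006), Ch. I §4 (p. 55). [MilneADT2006]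
* R. Greenberg, *On the structure of Selmer groups*, in: Elliptic Curves, Modular Forms and Iwasawa
  Theory, Springer PROMS 188 (2016), §1 p. 3 (the arena). [Greenberg2016Selmer]
* K. S. Brown, *Cohomology of Groups* (1982), III.1 Example 3 (cochains do not involve the scalars).
  [Brown1982CohomologyGroups]
-/

noncomputable section

open Function NumberField Field IsDedekindDomain CategoryTheory
open scoped NumberField ContRepresentation

namespace Literature.NumberTheory.IwasawaTheory.Greenberg2016

open Literature.NumberTheory.GaloisRepresentations
open Literature.NumberTheory.GaloisRepresentations.DiscreteGaloisModule (restrictedCohomology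
  restrictedLocalization restrictedInf)
open Literature.NumberTheory.GaloisCohomology

variable {K : Type} [Field K] [NumberField K] (S : Set (HeightOneSpectrum (𝓞 K)))
variable {Λ : Type} [CommRing Λ] [TopologicalSpace Λ]
variable {A : Type} [AddCommGroup A] [Module Λ A] [TopologicalSpace A] [DiscreteTopology A]
  [ContinuousSMul Λ A]
variable {B : Type} [AddCommGroup B] [Module Λ B] [TopologicalSpace B] [DiscreteTopology B]
  [ContinuousSMul Λ B]
variable (τ : ContinuousRep (GaloisGroupUnramifiedOutside K S) Λ A)
  (τ' : ContinuousRep (GaloisGroupUnramifiedOutside K S) Λ B)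

/-! ### §1. The inflated discrete `Γ_K`-module of a `G_{K,S}`-representation -/

/-- **`A` as a discrete `Γ_K`-module**: the `G_{K,S}`-representation `τ` pulled back along
`Γ_K ↠ G_{K,S} = Γ_K ⧸ N_S` with scalars restricted to `ℤ` — the term
`(τ.restrictScalars ℤ).restrict (toUnramifiedQuotCont K S)` of
`RestrictedRamificationFiniteCoefficients.lean`, as an `abbrev`. [cite: Harari2020, Def. 15.36 and §17.2 (p. 290)] -/
abbrev toGaloisModule : DiscreteGaloisModule K A :=
  (τ.restrictScalars ℤ).restrict (toUnramifiedQuotCont K S)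

omit [NumberField K] [ContinuousSMul Λ A] in
/-- Unfolding: `Γ_K` acts through its image in `G_{K,S}`. [cite: Harari2020, §17.2 (p. 290)] -/
theorem toGaloisModule_apply (s : absoluteGaloisGroup K) (a : A) :
    toGaloisModule S τ s a = τ (toUnramifiedQuot K S s) a := rfl

omit [NumberField K] [ContinuousSMul Λ A] in
/-- `N_S` acts trivially on the inflated module. [cite: Harari2020, Def. 15.36 and Remark 17.7 (b)] -/
theorem ramificationSubgroup_le_ker_toGaloisModule :
    ramificationSubgroup K S ≤ ContinuousRep.ker (toGaloisModule S τ) :=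
  ramificationSubgroup_le_ker_inflate S τ

omit [NumberField K] [ContinuousSMul Λ A] in
/-- The inflated module is unramified outside `S` ("`A` is a `G_S`-module").
[cite: Harari2020, Remark 17.7 (b) and Def. 15.36] -/
theorem isUnramifiedOutside_toGaloisModule :
    GaloisRep.IsUnramifiedOutside S (toGaloisModule S τ) :=
  isUnramifiedOutside_inflate S τ

omit [ContinuousSMul Λ A] in
/-- **The local module of the inflated module at a place `v` is Greenberg's `localRep S τ v`
with scalars restricted to `ℤ`** — definitionally (both are `τ ∘ (Γ_{K_v} → Γ_K ↠ G_{K,S})`).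
[cite: Harari2020, §17.2 (p. 290)] [cite: Greenberg2016Selmer, §1 p. 3 L26–28] -/
theorem toGaloisModule_toLocal (v : Place K) :
    (toGaloisModule S τ).toLocal v = (localRep S τ v).restrictScalars ℤ := rfl

/-! ### §2. The global comparison `Hⁿ(G_S, A^{N_S}) ≃+ Hⁿ(K_Σ/K, A)` -/

/-- The identification `A^{N_S} = A` (the inclusion; `N_S` acts trivially) as a continuous additive
equivalence — both sides discrete. [cite: Harari2020, Def. 15.36 and Remark 17.7 (b)] -/
def invariantsContinuousAddEquiv :
    Representation.invariants
        ((toGaloisModule S τ).toRepresentation.comp (ramificationSubgroup K S).subtype) ≃ₜ+ A :=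
  { ((toGaloisModule S τ).invariantsRamificationEquiv
      (ramificationSubgroup_le_ker_toGaloisModule S τ)).toAddEquiv with
    continuous_toFun := continuous_of_discreteTopology
    continuous_invFun := continuous_of_discreteTopology }

omit [NumberField K] [ContinuousSMul Λ A] in
/-- `invariantsContinuousAddEquiv` is the inclusion on elements. [cite: Harari2020, Def. 15.36] -/
@[simp] theorem invariantsContinuousAddEquiv_apply
    (w : Representation.invariants
      ((toGaloisModule S τ).toRepresentation.comp (ramificationSubgroup K S).subtype)) :
    invariantsContinuousAddEquiv S τ w = (w : A) := rfl

omit [NumberField K] [ContinuousSMul Λ A] in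
/-- Equivariance of `invariantsContinuousAddEquiv`: the `G_S`-action on `A^{N_S}`
(`quotientInvariants`) is carried to `τ`. [cite: Harari2020, §17.2 (p. 290)] -/
theorem invariantsContinuousAddEquiv_smul (g : GaloisGroupUnramifiedOutside K S)
    (w : Representation.invariants
      ((toGaloisModule S τ).toRepresentation.comp (ramificationSubgroup K S).subtype)) :
    invariantsContinuousAddEquiv S τ
        ((toGaloisModule S τ).quotientInvariants (ramificationSubgroup K S) g w) =
      τ g (invariantsContinuousAddEquiv S τ w) := by
  induction g using QuotientGroup.induction_on with
  | H s =>
    change (((toGaloisModule S τ).quotientInvariants (ramificationSubgroup K S)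
        (s : GaloisGroupUnramifiedOutside K S) w : Representation.invariants
          ((toGaloisModule S τ).toRepresentation.comp (ramificationSubgroup K S).subtype)) : A) =
      τ _ (w : A)
    rw [DiscreteGaloisModule.quotientInvariants_apply_coe]
    rfl

/-- **`Hⁿ(G_S, A^{N_S}) ≃+ Hⁿ(K_Σ/K, A)`** — the `ℤ`-linear `G_S`-cohomology of the `N_S`-invariants
of the inflated module (`restrictedCohomology`, the currency of the tree's Poitou–Tate theorems)
identified with the `Λ`-linear continuous cohomology `τ.H n` of Greenberg's arena: same group,
continuously-additively identified modules, matching actions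
(`ContinuousRep.HAddEquivOfContinuousAddEquiv`).  This is the witness of
`nonempty_restrictedCohomology_addEquiv_H`. [cite: Harari2020, §17.2 (p. 290) and Def. 15.36]
[cite: Brown1982CohomologyGroups, III.1 Example 3] -/
def restrictedHAddEquiv (n : ℕ) : restrictedCohomology (toGaloisModule S τ) S n ≃+ τ.H n :=
  ContinuousRep.HAddEquivOfContinuousAddEquiv
    ((toGaloisModule S τ).quotientInvariants (ramificationSubgroup K S)) τ
    (invariantsContinuousAddEquiv S τ) (invariantsContinuousAddEquiv_smul S τ) n

/-! ### §3. The local comparison `Hⁿ(Γ_{K_v}, A) ≃+ Hⁿ(K_v, A)` -/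

/-- **`Hⁿ(Γ_{K_v}, A|_ℤ) ≃+ (localRep S τ v).H n`**: the Galois cohomology of the local module of
`toGaloisModule S τ` at the place `v` — which IS `localRep S τ v` with scalars restricted to `ℤ`
(`toGaloisModule_toLocal`) — identified with Greenberg's `Hⁿ(K_v, A)`; restriction of scalars does
not change continuous cohomology (`ContinuousRep.restrictScalarsH`).
[cite: Greenberg2016Selmer, §1 p. 3 L26–28] [cite: Brown1982CohomologyGroups, III.1 Example 3] -/
def localHAddEquiv (v : Place K) (n : ℕ) :
    galoisCohomology ((toGaloisModule S τ).toLocal v) n ≃+ (localRep S τ v).H n :=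
  ContinuousRep.restrictScalarsH ℤ (localRep S τ v) n

/-! ### §4. Compatibility with localisation and with inflation -/

/-- **THE SQUARE `loc_v ∘ (Hⁿ(G_S, A^{N_S}) ≃ Hⁿ(K_Σ/K, A)) = (Hⁿ(Γ_{K_v}, A) ≃ Hⁿ(K_v, A)) ∘ loc_v`.**
Greenberg's localisation `loc S τ v n` of the transported class is the transport of the tree's
`restrictedLocalization` (inflation to `Γ_K` followed by localisation at `v`): both are `Hⁿ` of the
pair (`Γ_{K_v} → Γ_K ↠ G_{K,S}`, `A^{N_S} ⊆ A`) (Mathlib `ContinuousCohomology.map_comp`), and the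
comparison isomorphisms are natural (`continuousCohomologyAddEquiv_map`).
[cite: Harari2020, §17.2 (p. 290) and Lemma 17.8] [cite: MilneADT2006, Ch. I §4 (p. 55)] -/
theorem loc_restrictedHAddEquiv (v : Place K) (n : ℕ)
    (c : restrictedCohomology (toGaloisModule S τ) S n) :
    loc S τ v n (restrictedHAddEquiv S τ n c) =
      localHAddEquiv S τ v n (restrictedLocalization (toGaloisModule S τ) S v n c) := by
  -- the two coefficient morphisms on the `Γ_K`-side: `A^{N_S} ⊆ A` (for the inflation) and
  -- `A = A` (for the localisation), and their composite over `Γ_{K_v}`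
  let N := ramificationSubgroup K S
  let σ : DiscreteGaloisModule K A := toGaloisModule S τ
  let qm : absoluteGaloisGroup K →ₜ* GaloisGroupUnramifiedOutside K S :=
    ContinuousMonoidHom.quotientMk N
  let a : absoluteGaloisGroup (v.Completion) →ₜ* absoluteGaloisGroup K :=
    absGaloisRestrict K v.Completion
  let F : TopRep.res (qm : absoluteGaloisGroup K →* GaloisGroupUnramifiedOutside K S)
      (σ.quotientInvariants N).toTopRep ⟶ σ.toTopRep :=
    TopRep.ofHom ⟨Submodule.subtypeL _, fun _ => rfl⟩
  let G : TopRep.res (a : absoluteGaloisGroup (v.Completion) →* absoluteGaloisGroup K) σ.toTopRep ⟶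
      DiscreteGaloisModule.toTopRep (σ.toLocal v) :=
    TopRep.ofHom ⟨ContinuousLinearMap.id ℤ A, fun _ => rfl⟩
  -- naturality of the comparison isomorphisms for the pair (`qm ∘ a`, `G ∘ F|`)
  have key := continuousCohomologyAddEquiv_map
    (X := (σ.quotientInvariants N).toTopRep) (X' := τ.toTopRep)
    (Y := DiscreteGaloisModule.toTopRep (σ.toLocal v)) (Y' := (localRep S τ v).toTopRep)
    (invariantsContinuousAddEquiv S τ) (invariantsContinuousAddEquiv_smul S τ)
    (ContinuousAddEquiv.refl A) (fun _ _ => rfl)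
    (qm.comp a)
    ((TopRep.resFunctor (a : absoluteGaloisGroup (v.Completion) →* absoluteGaloisGroup K)).map F ≫ G)
    (TopRep.ofHom ⟨ContinuousLinearMap.id Λ A, fun _ => rfl⟩)
    (fun _ => rfl) n c
  rw [ContinuousCohomology.map_comp] at key
  have h1 : loc S τ v n (restrictedHAddEquiv S τ n c) =
      (ContinuousCohomology.map (qm.comp a) (X := τ.toTopRep) (Y := (localRep S τ v).toTopRep)
        (TopRep.ofHom ⟨ContinuousLinearMap.id Λ A, fun _ => rfl⟩) n).hom
        (continuousCohomologyAddEquiv (X := (σ.quotientInvariants N).toTopRep) (Y := τ.toTopRep)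
          (invariantsContinuousAddEquiv S τ) (invariantsContinuousAddEquiv_smul S τ) n c) := rfl
  have h2 : localHAddEquiv S τ v n (restrictedLocalization (toGaloisModule S τ) S v n c) =
      continuousCohomologyAddEquiv (X := DiscreteGaloisModule.toTopRep (σ.toLocal v))
        (Y := (localRep S τ v).toTopRep) (ContinuousAddEquiv.refl A) (fun _ _ => rfl) n
        ((ContinuousCohomology.map qm F n ≫ ContinuousCohomology.map a G n).hom c) := rfl
  rw [h1, h2]
  exact key.symm

omit [NumberField K] in
/-- **Inflation square**: Greenberg's pull-back `Hⁿ(K_Σ/K, A) → Hⁿ(Γ_K, A)` along `Γ_K ↠ G_{K,S}`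
(`ContinuousRep.Hpullback`) of the transported class is the transport (restriction of scalars only)
of the tree's inflation `restrictedInf : Hⁿ(G_S, A^{N_S}) → Hⁿ(Γ_K, A)`.
[cite: Harari2020, §17.2 (p. 290)] [cite: Brown1982CohomologyGroups, III.1 Example 3] -/
theorem Hpullback_restrictedHAddEquiv (n : ℕ) (c : restrictedCohomology (toGaloisModule S τ) S n) :
    τ.Hpullback (toUnramifiedQuotCont K S) n (restrictedHAddEquiv S τ n c) =
      ContinuousRep.restrictScalarsH ℤ (τ.restrict (toUnramifiedQuotCont K S)) n
        (restrictedInf (toGaloisModule S τ) S n c) := by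
  let N := ramificationSubgroup K S
  let σ : DiscreteGaloisModule K A := toGaloisModule S τ
  have key := continuousCohomologyAddEquiv_map
    (X := (σ.quotientInvariants N).toTopRep) (X' := τ.toTopRep)
    (Y := σ.toTopRep) (Y' := (τ.restrict (toUnramifiedQuotCont K S)).toTopRep)
    (invariantsContinuousAddEquiv S τ) (invariantsContinuousAddEquiv_smul S τ)
    (ContinuousAddEquiv.refl A) (fun _ _ => rfl)
    (ContinuousMonoidHom.quotientMk N)
    (TopRep.ofHom ⟨Submodule.subtypeL _, fun _ => rfl⟩)
    (TopRep.ofHom ⟨ContinuousLinearMap.id Λ A, fun _ => rfl⟩)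
    (fun _ => rfl) n c
  exact key.symm

/-! ### §5. Naturality in the coefficient module -/

section Coefficients

variable (u : A →L[Λ] B) (hu : ∀ (g : GaloisGroupUnramifiedOutside K S) (a : A), u (τ g a) = τ' g (u a))

/-- The morphism of inflated `Γ_K`-modules induced by a `G_{K,S}`-equivariant continuous `Λ`-linear
map `u : A → B` (scalars restricted to `ℤ`). [cite: Harari2020, §17.2 (p. 290)] -/
def toGaloisModuleHom : (toGaloisModule S τ).toTopRep ⟶ (toGaloisModule S τ').toTopRep :=
  TopRep.ofHom ⟨(u.restrictScalars ℤ : A →L[ℤ] B), fun s => by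
    ext a
    exact hu (toUnramifiedQuot K S s) a⟩

omit [NumberField K] [ContinuousSMul Λ A] [ContinuousSMul Λ B] in
/-- `toGaloisModuleHom` is `u` on elements. [cite: Harari2020, §17.2 (p. 290)] -/
@[simp] theorem toGaloisModuleHom_hom_apply (a : A) : (toGaloisModuleHom S τ τ' u hu).hom a = u a := rfl

omit [NumberField K] in
/-- **Coefficient naturality of the global comparison**: `Hmap(u) ∘ restrictedHAddEquiv =
restrictedHAddEquiv ∘ Hⁿ(G_S, u|_{A^{N_S}})`, the right-hand map on `restrictedCohomology` being
Mathlib's `ContinuousCohomology.map (id) (ContinuousRep.invariantsHom (toGaloisModuleHom u))`.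
[cite: Harari2020, §17.2 (p. 290)] [cite: Brown1982CohomologyGroups, III.1 Example 3] -/
theorem Hmap_restrictedHAddEquiv (n : ℕ) (c : restrictedCohomology (toGaloisModule S τ) S n) :
    Hmap τ τ' u hu n (restrictedHAddEquiv S τ n c) =
      restrictedHAddEquiv S τ' n
        ((ContinuousCohomology.map (ContinuousMonoidHom.id (GaloisGroupUnramifiedOutside K S))
          (ContinuousRep.invariantsHom (N := ramificationSubgroup K S)
            (toGaloisModuleHom S τ τ' u hu)) n).hom c) := by
  let N := ramificationSubgroup K S
  let σ : DiscreteGaloisModule K A := toGaloisModule S τ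
  let σ' : DiscreteGaloisModule K B := toGaloisModule S τ'
  have key := continuousCohomologyAddEquiv_map
    (X := (σ.quotientInvariants N).toTopRep) (X' := τ.toTopRep)
    (Y := (σ'.quotientInvariants N).toTopRep) (Y' := τ'.toTopRep)
    (invariantsContinuousAddEquiv S τ) (invariantsContinuousAddEquiv_smul S τ)
    (invariantsContinuousAddEquiv S τ') (invariantsContinuousAddEquiv_smul S τ')
    (ContinuousMonoidHom.id (GaloisGroupUnramifiedOutside K S))
    (ContinuousRep.invariantsHom (N := N) (toGaloisModuleHom S τ τ' u hu))
    (TopRep.ofHom ⟨u, fun g => by ext a; exact hu g a⟩)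
    (fun _ => rfl) n c
  exact key.symm

/-- The intertwining map of LOCAL modules at `v` induced by `u` (the restriction of `u` to
`Γ_{K_v}`-modules, scalars `ℤ`). [cite: Harari2020, §17.2 (p. 290)] -/
def toGaloisModuleLocalHom (v : Place K) :
    ((toGaloisModule S τ).toLocal v).toContRepresentation →ⁱL
      ((toGaloisModule S τ').toLocal v).toContRepresentation :=
  ⟨(u.restrictScalars ℤ : A →L[ℤ] B), fun s => by
    ext a
    exact hu (toUnramifiedQuot K S (absGaloisRestrict K v.Completion s)) a⟩

omit [ContinuousSMul Λ A] [ContinuousSMul Λ B] in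
/-- `toGaloisModuleLocalHom` is `u` on elements. [cite: Harari2020, §17.2 (p. 290)] -/
@[simp] theorem toGaloisModuleLocalHom_apply (v : Place K) (a : A) :
    (toGaloisModuleLocalHom S τ τ' u hu v).toContinuousLinearMap a = u a := rfl

/-- **Coefficient naturality of the local comparison**: `Hmap(u) ∘ localHAddEquiv =
localHAddEquiv ∘ galoisCohomology.map (u|_{Γ_{K_v}})`. [cite: Harari2020, §17.2 (p. 290)]
[cite: Brown1982CohomologyGroups, III.1 Example 3] -/
theorem Hmap_localHAddEquiv (v : Place K) (n : ℕ)
    (z : galoisCohomology ((toGaloisModule S τ).toLocal v) n) :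
    Hmap (localRep S τ v) (localRep S τ' v) u
        (fun g a => hu (localToUnramified S v g) a) n (localHAddEquiv S τ v n z) =
      localHAddEquiv S τ' v n
        (galoisCohomology.map (toGaloisModuleLocalHom S τ τ' u hu v) n z) := by
  let σ : DiscreteGaloisModule K A := toGaloisModule S τ
  let σ' : DiscreteGaloisModule K B := toGaloisModule S τ'
  have key := continuousCohomologyAddEquiv_map
    (X := DiscreteGaloisModule.toTopRep (σ.toLocal v)) (X' := (localRep S τ v).toTopRep)
    (Y := DiscreteGaloisModule.toTopRep (σ'.toLocal v)) (Y' := (localRep S τ' v).toTopRep)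
    (ContinuousAddEquiv.refl A) (fun _ _ => rfl)
    (ContinuousAddEquiv.refl B) (fun _ _ => rfl)
    (ContinuousMonoidHom.id (absoluteGaloisGroup (v.Completion)))
    (TopRep.ofHom ⟨(toGaloisModuleLocalHom S τ τ' u hu v).toContinuousLinearMap,
      (toGaloisModuleLocalHom S τ τ' u hu v).isIntertwining'⟩)
    (TopRep.ofHom ⟨u, fun g => by ext a; exact hu (localToUnramified S v g) a⟩)
    (fun _ => rfl) n z
  exact key.symm

end Coefficients

end Literature.NumberTheory.IwasawaTheory.Greenberg2016

end
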